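import Literature.Geometry.Lorentzian.SenWittenOperator
import Literature.Geometry.Lorentzian.LeviCivitaProofs
import Literature.Geometry.Lorentzian.CurvatureProofs
import Literature.Geometry.Lorentzian.CurvatureSymmetries
import HarnessLib

/-!
# Smoothness of the Sen–Witten objects along smooth frames

Third brick of the analytic engine of Witten's proof of the positive energy theorem in the Pauli
model (`SenWittenOperator.lean`): on a data manifold `(X, h, k)` with a SMOOTH global
`h`-orthonormal frame `F`, all the objects of the engine built from a smooth spinor field are
smooth functions / smooth vector fields —

* `SenWitten.contMDiffAt_leviCivita_apply` — `∇_W Y` is a smooth field for smooth fields `Y, W`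
  (the Levi-Civita connection of a smooth metric is smooth, `contMDiffAt_inCoordinates_leviCivita`);
* `SenWitten.contMDiff_connCoeff_apply`, `contMDiff_k_apply` — `y ↦ ω_{ij}(W_y)` and
  `y ↦ k(A_y, B_y)` are smooth;
* `SenWitten.contMDiff_spinConnForm_apply`, `contMDiff_senForm_apply` — `y ↦ A(W_y)φ(y)`,
  `y ↦ K(W_y)φ(y)` are smooth for smooth `W`, `φ`;
* `SenWitten.contMDiff_spinCovDeriv_apply`, `contMDiff_senCovDeriv_apply` — `y ↦ ∇_{W}ψ`,
  `y ↦ ∇̂_{W}ψ` are smooth; `contMDiff_dirac`, `contMDiff_wittenDirac`, `contMDiff_energyDensity`,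
  `contMDiff_current`, `contMDiff_wittenFlux` — `D̸ψ`, `𝒟ψ`, `Σ‖∇̂ᵢψ‖²`, `Y_ψ` and Witten's
  flux field are smooth.

These are the regularity inputs of the divergence identities and of the divergence theorem
(`integral_vectorDivergence_eq_zero_of_hasCompactSupport`) in the integrated Lichnerowicz–Witten
formula (Parker–Taubes 1982, (3.2)). All proved; no definitions, no named facts.

## References

* T. Parker, C. H. Taubes, *On Witten's proof of the positive energy theorem*, Comm. Math. Phys.
  84 (1982) 223–238, §3. [ParkerTaubes1982]
* S. Gallot, D. Hulin, J. Lafontaine, *Riemannian Geometry*, 3rd ed., Springer 2004, Prop. 2.54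
  (smoothness of the Levi-Civita connection). [GallotHulinLafontaine2004]
-/

noncomputable section

open Bundle Set Function Manifold Finset Filter
open scoped Manifold ContDiff Topology RealInnerProductSpace

namespace Literature.Geometry.Lorentzian

namespace SenWitten

open PauliModel

variable {X : Type*} [TopologicalSpace X] [ChartedSpace E3 X] [IsManifold (𝓡 3) ∞ X]
  (D : InitialDataSet (𝓡 3) X) (F : Fin 3 → Π x : X, TangentSpace (𝓡 3) x)

/-! ### The Levi-Civita connection and the data on smooth fields -/

section Fields

variable [D.metric.HasLeviCivita]

/-- **`∇_W Y` is smooth** for a smooth vector field `Y` and a field `W` smooth at the point (the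
Levi-Civita connection of the smooth metric `h` maps smooth fields to smooth sections of
`Hom(TX, TX)`, `contMDiffAt_inCoordinates_leviCivita`). Gallot–Hulin–Lafontaine 2004,
Prop. 2.54. [cite: GallotHulinLafontaine2004, Prop. 2.54] -/
theorem contMDiffAt_leviCivita_apply {Y W : Π x : X, TangentSpace (𝓡 3) x}
    (hY : ContMDiff (𝓡 3) ((𝓡 3).prod 𝓘(ℝ, E3)) ∞
      (fun y ↦ (TotalSpace.mk' E3 y (Y y) : TangentBundle (𝓡 3) X)))
    {x : X} (hW : ContMDiffAt (𝓡 3) ((𝓡 3).prod 𝓘(ℝ, E3)) ∞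
      (fun y ↦ (TotalSpace.mk' E3 y (W y) : TangentBundle (𝓡 3) X)) x) :
    ContMDiffAt (𝓡 3) ((𝓡 3).prod 𝓘(ℝ, E3)) ∞
      (fun y ↦ (TotalSpace.mk' E3 y (D.metric.leviCivita Y y (W y)) : TangentBundle (𝓡 3) X)) x := by
  have htop : (((⊤ : ℕ∞) : ℕ∞ω) + 1) ≤ ∞ := by exact_mod_cast le_top
  have hLC : ContMDiffAt (𝓡 3) ((𝓡 3).prod 𝓘(ℝ, E3 →L[ℝ] E3)) ∞
      (fun y ↦ TotalSpace.mk' (E3 →L[ℝ] E3)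
        (E := fun y : X ↦ TangentSpace (𝓡 3) y →L[ℝ] TangentSpace (𝓡 3) y) y
          (D.metric.leviCivita Y y)) x := by
    rw [contMDiffAt_hom_bundle]
    exact ⟨contMDiffAt_id, D.metric.contMDiffAt_inCoordinates_leviCivita ⊤ htop isOpen_univ
      (mem_univ x) ((hY.of_le htop).contMDiffOn)⟩
  exact hLC.clm_bundle_apply hW

/-- **The connection coefficients along a smooth field are smooth**: `y ↦ ω_{ij}(W_y)` is smooth
for a smooth frame and a smooth field `W`. [cite: GallotHulinLafontaine2004, Prop. 2.54] -/
theorem contMDiff_connCoeff_apply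
    (hF : ∀ i, ContMDiff (𝓡 3) ((𝓡 3).prod 𝓘(ℝ, E3)) ∞
      (fun y ↦ (TotalSpace.mk' E3 y (F i y) : TangentBundle (𝓡 3) X)))
    {W : Π x : X, TangentSpace (𝓡 3) x}
    (hW : ContMDiff (𝓡 3) ((𝓡 3).prod 𝓘(ℝ, E3)) ∞
      (fun y ↦ (TotalSpace.mk' E3 y (W y) : TangentBundle (𝓡 3) X))) (i j : Fin 3) :
    ContMDiff (𝓡 3) 𝓘(ℝ, ℝ) ∞ (fun y ↦ connCoeff D F i j y (W y)) := fun x ↦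
  PseudoRiemannianMetric.contMDiffAt_val_apply (g := D.metric) le_rfl
    (contMDiffAt_leviCivita_apply D (hF i) (hW x)) (hF j x)

omit [D.metric.HasLeviCivita] in
/-- **`y ↦ k(A_y, B_y)` is smooth** for smooth fields `A`, `B` (`k` is a smooth section of the
bundle of bilinear forms). [folklore] -/
theorem contMDiff_k_apply {A B : Π x : X, TangentSpace (𝓡 3) x}
    (hA : ContMDiff (𝓡 3) ((𝓡 3).prod 𝓘(ℝ, E3)) ∞
      (fun y ↦ (TotalSpace.mk' E3 y (A y) : TangentBundle (𝓡 3) X)))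
    (hB : ContMDiff (𝓡 3) ((𝓡 3).prod 𝓘(ℝ, E3)) ∞
      (fun y ↦ (TotalSpace.mk' E3 y (B y) : TangentBundle (𝓡 3) X))) :
    ContMDiff (𝓡 3) 𝓘(ℝ, ℝ) ∞ (fun y ↦ D.k y (A y) (B y)) := by
  intro x
  have : ContMDiffAt (𝓡 3) ((𝓡 3).prod 𝓘(ℝ, ℝ)) ∞
      (fun y ↦ TotalSpace.mk' ℝ (E := Bundle.Trivial X ℝ) y (D.k y (A y) (B y))) x := by
    apply ContMDiffAt.clm_bundle_apply₂ (F₁ := E3) (F₂ := E3)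
    · exact D.contMDiff_k x
    · exact hA x
    · exact hB x
  simp only [contMDiffAt_totalSpace] at this
  exact this.2

end Fields

/-! ### The connection forms applied to smooth spinor fields -/

section Forms

variable [D.metric.HasLeviCivita]

/-- **`y ↦ A(W_y) φ(y)` is smooth** for a smooth frame, a smooth field `W` and a smooth spinor
field `φ`. [cite: ParkerTaubes1982, §3] -/
theorem contMDiff_spinConnForm_apply
    (hF : ∀ i, ContMDiff (𝓡 3) ((𝓡 3).prod 𝓘(ℝ, E3)) ∞
      (fun y ↦ (TotalSpace.mk' E3 y (F i y) : TangentBundle (𝓡 3) X)))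
    {W : Π x : X, TangentSpace (𝓡 3) x}
    (hW : ContMDiff (𝓡 3) ((𝓡 3).prod 𝓘(ℝ, E3)) ∞
      (fun y ↦ (TotalSpace.mk' E3 y (W y) : TangentBundle (𝓡 3) X)))
    {φ : X → Spinor} (hφ : ContMDiff (𝓡 3) 𝓘(ℝ, Spinor) ∞ φ) :
    ContMDiff (𝓡 3) 𝓘(ℝ, Spinor) ∞ (fun y ↦ spinConnForm D F y (W y) (φ y)) := by
  have h : (fun y ↦ spinConnForm D F y (W y) (φ y)) =
      fun y ↦ -((1 / 4 : ℝ) • ∑ i, ∑ j, connCoeff D F i j y (W y) • pauli i (pauli j (φ y))) :=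
    funext fun y ↦ spinConnForm_apply D F y (W y) (φ y)
  rw [h]
  refine contDiff_neg.comp_contMDiff ((contDiff_const_smul (1 / 4 : ℝ)).comp_contMDiff
    (ContMDiff.sum fun i _ ↦ ContMDiff.sum fun j _ ↦ ?_))
  exact (contMDiff_connCoeff_apply D F hF hW i j).smul
    (SenParallel.contMDiff_clm_apply_comp _ (SenParallel.contMDiff_clm_apply_comp _ hφ))

omit [D.metric.HasLeviCivita] in
/-- **`y ↦ K(W_y) φ(y)` is smooth** for a smooth frame, a smooth field `W` and a smooth spinor
field `φ`. [cite: ParkerTaubes1982, §3] -/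
theorem contMDiff_senForm_apply
    (hF : ∀ i, ContMDiff (𝓡 3) ((𝓡 3).prod 𝓘(ℝ, E3)) ∞
      (fun y ↦ (TotalSpace.mk' E3 y (F i y) : TangentBundle (𝓡 3) X)))
    {W : Π x : X, TangentSpace (𝓡 3) x}
    (hW : ContMDiff (𝓡 3) ((𝓡 3).prod 𝓘(ℝ, E3)) ∞
      (fun y ↦ (TotalSpace.mk' E3 y (W y) : TangentBundle (𝓡 3) X)))
    {φ : X → Spinor} (hφ : ContMDiff (𝓡 3) 𝓘(ℝ, Spinor) ∞ φ) :
    ContMDiff (𝓡 3) 𝓘(ℝ, Spinor) ∞ (fun y ↦ senForm D F y (W y) (φ y)) := by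
  have h : (fun y ↦ senForm D F y (W y) (φ y)) =
      fun y ↦ (1 / 2 : ℝ) • ∑ i, D.k y (W y) (F i y) • pauli i (φ y) :=
    funext fun y ↦ senForm_apply D F y (W y) (φ y)
  rw [h]
  refine (contDiff_const_smul (1 / 2 : ℝ)).comp_contMDiff (ContMDiff.sum fun i _ ↦ ?_)
  exact (contMDiff_k_apply D hW (hF i)).smul (SenParallel.contMDiff_clm_apply_comp _ hφ)

end Forms

/-! ### Covariant derivatives, Dirac operators, energy density, current and flux -/

section Operators

variable [D.metric.HasLeviCivita]

/-- **`y ↦ dψ_y(W_y)` is smooth** for a smooth spinor field and a smooth field `W`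
(`VectorField.contMDiffAt_mvfderiv_apply_of_contMDiffAt`). [folklore] -/
theorem contMDiff_mvfderiv_apply {W : Π x : X, TangentSpace (𝓡 3) x}
    (hW : ContMDiff (𝓡 3) ((𝓡 3).prod 𝓘(ℝ, E3)) ∞
      (fun y ↦ (TotalSpace.mk' E3 y (W y) : TangentBundle (𝓡 3) X)))
    {ψ : X → Spinor} (hψ : ContMDiff (𝓡 3) 𝓘(ℝ, Spinor) ∞ ψ) :
    ContMDiff (𝓡 3) 𝓘(ℝ, Spinor) ∞ (fun y ↦ mvfderiv (𝓡 3) ψ y (W y)) := fun x ↦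
  VectorField.contMDiffAt_mvfderiv_apply_of_contMDiffAt (hψ x) (hW x)
    (by exact_mod_cast le_top)

/-- **`y ↦ ∇_{W}ψ (y)` is smooth.** [cite: ParkerTaubes1982, §3] -/
theorem contMDiff_spinCovDeriv_apply
    (hF : ∀ i, ContMDiff (𝓡 3) ((𝓡 3).prod 𝓘(ℝ, E3)) ∞
      (fun y ↦ (TotalSpace.mk' E3 y (F i y) : TangentBundle (𝓡 3) X)))
    {W : Π x : X, TangentSpace (𝓡 3) x}
    (hW : ContMDiff (𝓡 3) ((𝓡 3).prod 𝓘(ℝ, E3)) ∞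
      (fun y ↦ (TotalSpace.mk' E3 y (W y) : TangentBundle (𝓡 3) X)))
    {ψ : X → Spinor} (hψ : ContMDiff (𝓡 3) 𝓘(ℝ, Spinor) ∞ ψ) :
    ContMDiff (𝓡 3) 𝓘(ℝ, Spinor) ∞ (fun y ↦ spinCovDeriv D F ψ y (W y)) :=
  (contMDiff_mvfderiv_apply hW hψ).add (contMDiff_spinConnForm_apply D F hF hW hψ)

/-- **`y ↦ ∇̂_{W}ψ (y)` is smooth.** [cite: ParkerTaubes1982, §3] -/
theorem contMDiff_senCovDeriv_apply
    (hF : ∀ i, ContMDiff (𝓡 3) ((𝓡 3).prod 𝓘(ℝ, E3)) ∞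
      (fun y ↦ (TotalSpace.mk' E3 y (F i y) : TangentBundle (𝓡 3) X)))
    {W : Π x : X, TangentSpace (𝓡 3) x}
    (hW : ContMDiff (𝓡 3) ((𝓡 3).prod 𝓘(ℝ, E3)) ∞
      (fun y ↦ (TotalSpace.mk' E3 y (W y) : TangentBundle (𝓡 3) X)))
    {ψ : X → Spinor} (hψ : ContMDiff (𝓡 3) 𝓘(ℝ, Spinor) ∞ ψ) :
    ContMDiff (𝓡 3) 𝓘(ℝ, Spinor) ∞ (fun y ↦ senCovDeriv D F ψ y (W y)) :=
  (contMDiff_spinCovDeriv_apply D F hF hW hψ).add (contMDiff_senForm_apply D F hF hW hψ)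

/-- **The Riemannian Dirac operator of a smooth spinor field is smooth.** [cite: ParkerTaubes1982, §3] -/
theorem contMDiff_dirac
    (hF : ∀ i, ContMDiff (𝓡 3) ((𝓡 3).prod 𝓘(ℝ, E3)) ∞
      (fun y ↦ (TotalSpace.mk' E3 y (F i y) : TangentBundle (𝓡 3) X)))
    {ψ : X → Spinor} (hψ : ContMDiff (𝓡 3) 𝓘(ℝ, Spinor) ∞ ψ) :
    ContMDiff (𝓡 3) 𝓘(ℝ, Spinor) ∞ (dirac D F ψ) := by
  have h : dirac D F ψ = fun y ↦ ∑ i, pauli i (spinCovDeriv D F ψ y (F i y)) :=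
    funext fun y ↦ dirac_apply D F ψ y
  rw [h]
  exact ContMDiff.sum fun i _ ↦
    SenParallel.contMDiff_clm_apply_comp _ (contMDiff_spinCovDeriv_apply D F hF (hF i) hψ)

/-- **Witten's operator of a smooth spinor field is smooth.** [cite: ParkerTaubes1982, §3] -/
theorem contMDiff_wittenDirac
    (hF : ∀ i, ContMDiff (𝓡 3) ((𝓡 3).prod 𝓘(ℝ, E3)) ∞
      (fun y ↦ (TotalSpace.mk' E3 y (F i y) : TangentBundle (𝓡 3) X)))
    {ψ : X → Spinor} (hψ : ContMDiff (𝓡 3) 𝓘(ℝ, Spinor) ∞ ψ) :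
    ContMDiff (𝓡 3) 𝓘(ℝ, Spinor) ∞ (wittenDirac D F ψ) := by
  have h : wittenDirac D F ψ = fun y ↦ ∑ i, pauli i (senCovDeriv D F ψ y (F i y)) :=
    funext fun y ↦ wittenDirac_apply D F ψ y
  rw [h]
  exact ContMDiff.sum fun i _ ↦
    SenParallel.contMDiff_clm_apply_comp _ (contMDiff_senCovDeriv_apply D F hF (hF i) hψ)

/-- **The Sen–Witten energy density of a smooth spinor field is smooth.** [cite: ParkerTaubes1982, (4.1)] -/
theorem contMDiff_energyDensity
    (hF : ∀ i, ContMDiff (𝓡 3) ((𝓡 3).prod 𝓘(ℝ, E3)) ∞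
      (fun y ↦ (TotalSpace.mk' E3 y (F i y) : TangentBundle (𝓡 3) X)))
    {ψ : X → Spinor} (hψ : ContMDiff (𝓡 3) 𝓘(ℝ, Spinor) ∞ ψ) :
    ContMDiff (𝓡 3) 𝓘(ℝ, ℝ) ∞ (energyDensity D F ψ) := by
  have h : energyDensity D F ψ = fun y ↦ ∑ i, ‖senCovDeriv D F ψ y (F i y)‖ ^ 2 :=
    funext fun y ↦ energyDensity_apply D F ψ y
  rw [h]
  refine ContMDiff.sum fun i _ ↦ ?_
  have hs := contMDiff_senCovDeriv_apply D F hF (hF i) hψ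
  have : (fun y ↦ ‖senCovDeriv D F ψ y (F i y)‖ ^ 2) =
      fun y ↦ ⟪senCovDeriv D F ψ y (F i y), senCovDeriv D F ψ y (F i y)⟫ :=
    funext fun y ↦ (real_inner_self_eq_norm_sq _).symm
  rw [this]
  exact SenParallel.contMDiff_real_inner hs hs

omit [D.metric.HasLeviCivita] in
/-- **The current of a smooth spinor field is a smooth vector field.** [cite: BeigChrusciel1996, App. A, (A.11.0)] -/
theorem contMDiff_current
    (hF : ∀ i, ContMDiff (𝓡 3) ((𝓡 3).prod 𝓘(ℝ, E3)) ∞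
      (fun y ↦ (TotalSpace.mk' E3 y (F i y) : TangentBundle (𝓡 3) X)))
    {ψ : X → Spinor} (hψ : ContMDiff (𝓡 3) 𝓘(ℝ, Spinor) ∞ ψ) :
    ContMDiff (𝓡 3) ((𝓡 3).prod 𝓘(ℝ, E3)) ∞
      (fun y ↦ (TotalSpace.mk' E3 y (current F ψ y) : TangentBundle (𝓡 3) X)) :=
  ContMDiff.sum_section fun i _ ↦
    (SenParallel.contMDiff_real_inner hψ (SenParallel.contMDiff_clm_apply_comp _ hψ)).smul_section
      (hF i)

/-- **Witten's flux field of a smooth spinor field is a smooth vector field** (hence `C¹`, as the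
divergence theorem requires). [cite: ParkerTaubes1982, (4.2)] -/
theorem contMDiff_wittenFlux
    (hF : ∀ i, ContMDiff (𝓡 3) ((𝓡 3).prod 𝓘(ℝ, E3)) ∞
      (fun y ↦ (TotalSpace.mk' E3 y (F i y) : TangentBundle (𝓡 3) X)))
    {ψ : X → Spinor} (hψ : ContMDiff (𝓡 3) 𝓘(ℝ, Spinor) ∞ ψ) :
    ContMDiff (𝓡 3) ((𝓡 3).prod 𝓘(ℝ, E3)) ∞
      (fun y ↦ (TotalSpace.mk' E3 y (wittenFlux D F ψ y) : TangentBundle (𝓡 3) X)) := by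
  have hc : ∀ i, ContMDiff (𝓡 3) 𝓘(ℝ, ℝ) ∞ (fun y ↦
      ⟪pauli i (ψ y), wittenDirac D F ψ y⟫ - ⟪ψ y, senCovDeriv D F ψ y (F i y)⟫) := fun i ↦
    (SenParallel.contMDiff_real_inner (SenParallel.contMDiff_clm_apply_comp _ hψ)
      (contMDiff_wittenDirac D F hF hψ)).sub
      (SenParallel.contMDiff_real_inner hψ (contMDiff_senCovDeriv_apply D F hF (hF i) hψ))
  exact ContMDiff.sum_section fun i _ ↦ (hc i).smul_section (hF i)

end Operators

end SenWitten

end Literature.Geometry.Lorentzian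

end
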